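/-
Copyright: rh-split cell (screw, prover seat l22) gen 0, 2026-08-27.  D-0145 line L22
(route-RiemannHypothesis-ScrewQuarticNodes, desk rh-idea-9).  The door below is a DETECTION theorem
(hypotheses about `ζ`'s own screw function imply RH); the route's residual `QuarticNodePositivity` is
RH-equivalent by declaration.  Nothing here bears on the truth of RH.
-/
import Summits.RiemannHypothesis.RiemannHypothesis.Theorems.IntegerScrewDiscreteLandau
import Summits.RiemannHypothesis.RiemannHypothesis.Theses.ScrewQuarticNodes

/-!
# `ScrewQuarticNodes.SparseNodeDoor` (stmt-RiemannHypothesis-22169) — PROVED: the RH-free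
# Nyquist-3/4 sparse-node screw door

`Ψ = zetaScrew` is Suzuki's screw function of `ζ` (Suzuki2023 (1.1),
`Literature.NumberTheory.LFunctions.zetaScrew`).  Main result (`sparseNodeDoor`): for every `K > 0`
and every node set `N ⊆ ℝ` meeting every interval `[a, a + √(K/(e^{(a+2)/2}+1))]` for all large `a`,
the one-sided node bound `Ψ ≥ -K` on `N` implies the Riemann hypothesis; `sparseNodeDoor_proof`
restates it as the route decl `Theses.ScrewQuarticNodes.SparseNodeDoor` (closed BY NAME, by `unfold`).

## Proof (brief `BRIEF-SparseNodeDoor.md` of rh-idea-9, critic idea-crit-2 PASS-WITH-PRICE)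

1. PRIME-SIDE SEMICONCAVITY (`concaveOn_zetaScrew_sub_quad`, `zetaScrew_le_taylor`).  By (1.1), for
   `t ≥ 0`, `Ψ(t) = S(t) - φ(t) - ¼ e^{-t/2} Φ(e^{-2t}, 2, ¼)` with
   `S(t) = 4(e^{t/2} + e^{-t/2} - 2) - c₀ t/2 + C/4` smooth, `S'' = e^{t/2} + e^{-t/2}`, the prime
   hinge sum `φ(t) = ∑_n Λ(n) n^{-1/2} (t - log n)₊` CONVEX (`convexOn_zetaScrewPrimeSum`) and the
   Hurwitz–Lerch term `e^{-t/2} Φ = ∑_k e^{-(2k+½)t} (k+¼)^{-2}` CONVEX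
   (`convexOn_exp_mul_hurwitzLerchQuarter`).  Hence for `t₀ ≥ 1` and `M = e^{(t₀+1)/2} + 1 ≥ sup S''`
   on the window `[t₀-1, t₀+1]`, `Ψ - M t²/2` is concave there, and a supergradient
   (`exists_supergradient_of_concaveOn`, from Mathlib's one-sided derivatives of convex functions)
   gives the one-sided Taylor bound `Ψ(t) ≤ Ψ(t₀) + p (t - t₀) + ½ M (t - t₀)²` on the window.
2. NYQUIST STEP (`tailFloor`).  If `Ψ(t₀) < -2K` with `t₀` large, the bound keeps `Ψ < -K` on the
   one-sided window of length `δ = √(K/M)` next to `t₀` (right if `p ≤ 0`, left if `p > 0`); the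
   density hypothesis puts a node there (`g(a) ≤ δ` because `a + 2 ≥ t₀ + 1`), contradicting
   `Ψ ≥ -K` on `N`.  So `Ψ ≥ -2K` eventually; with continuity on `[0, T₁]`, `Ψ ≥ -K'` on `[0, ∞)`
   (`globalFloor`).
3. ROBUST LANDAU (tree `IntegerScrewDiscreteLandau.robustLandau`, MontgomeryVaughan2007 §15.1 run on
   `Ψ∘log + K'`): no zero of `ξ(1/2 + ·)` in `Re > 0`, i.e. no zero of `ζ` in `1/2 < Re s < 1`, which
   is RH (`quasiRiemannHypothesis_one_half_iff_holds`) — glue verbatim from `DiscreteLandau_proof`.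

Axioms: propext, Classical.choice, Quot.sound.  References: Suzuki2023 (1.1), Thm 1.7;
MontgomeryVaughan2007 §15.1.
-/

noncomputable section

open Real Set Filter Topology

namespace Summit.RiemannHypothesis.RiemannHypothesis.Theorems.ScrewQuarticNodesSparseNodeDoor

open Literature.NumberTheory.LFunctions

/-! ## Convexity of the pieces of `Ψ` -/

/-- The archimedean-plus-affine part of `Ψ` minus the quadratic `M t²/2` is concave on `[a, b]`
as soon as `0 ≤ a` and `e^{b/2} + 1 ≤ M` (its second derivative is `e^{t/2} + e^{-t/2} - M ≤ 0`
there). -/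
theorem concaveOn_arch_sub_quad {a b M : ℝ} (α β : ℝ) (ha : 0 ≤ a)
    (hM : Real.exp (b / 2) + 1 ≤ M) :
    ConcaveOn ℝ (Icc a b) (fun t : ℝ =>
      4 * (Real.exp (t / 2) + Real.exp (-(t / 2)) - 2) + α * t + β - M / 2 * t ^ 2) := by
  set f : ℝ → ℝ := fun t =>
    4 * (Real.exp (t / 2) + Real.exp (-(t / 2)) - 2) + α * t + β - M / 2 * t ^ 2 with hf
  set f' : ℝ → ℝ := fun t => 2 * Real.exp (t / 2) - 2 * Real.exp (-(t / 2)) + α - M * t with hf'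
  set f'' : ℝ → ℝ := fun t => Real.exp (t / 2) + Real.exp (-(t / 2)) - M with hf''
  have hd1 : ∀ t, HasDerivAt f (f' t) t := by
    intro t
    have h1 : HasDerivAt (fun x : ℝ => Real.exp (x / 2)) (Real.exp (t / 2) * (1 / 2)) t :=
      ((hasDerivAt_id' t).div_const 2).exp
    have h2 : HasDerivAt (fun x : ℝ => Real.exp (-(x / 2))) (Real.exp (-(t / 2)) * (-(1 / 2))) t :=
      ((hasDerivAt_id' t).div_const 2).neg.exp
    have h3 : HasDerivAt (fun x : ℝ => α * x) (α * 1) t := (hasDerivAt_id' t).const_mul α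
    have h4 : HasDerivAt (fun x : ℝ => M / 2 * x ^ 2) (M / 2 * ((2 : ℕ) * t ^ (2 - 1))) t :=
      (hasDerivAt_pow 2 t).const_mul (M / 2)
    have h : HasDerivAt f (4 * (Real.exp (t / 2) * (1 / 2) + Real.exp (-(t / 2)) * (-(1 / 2)))
        + α * 1 - M / 2 * ((2 : ℕ) * t ^ (2 - 1))) t :=
      ((((h1.add h2).sub_const 2).const_mul 4).add h3).add_const β |>.sub h4
    refine h.congr_deriv ?_
    simp only [hf']
    push_cast
    ring
  have hd2 : ∀ t, HasDerivAt f' (f'' t) t := by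
    intro t
    have h1 : HasDerivAt (fun x : ℝ => Real.exp (x / 2)) (Real.exp (t / 2) * (1 / 2)) t :=
      ((hasDerivAt_id' t).div_const 2).exp
    have h2 : HasDerivAt (fun x : ℝ => Real.exp (-(x / 2))) (Real.exp (-(t / 2)) * (-(1 / 2))) t :=
      ((hasDerivAt_id' t).div_const 2).neg.exp
    have h3 : HasDerivAt (fun x : ℝ => M * x) (M * 1) t := (hasDerivAt_id' t).const_mul M
    have h : HasDerivAt f' (2 * (Real.exp (t / 2) * (1 / 2)) - 2 * (Real.exp (-(t / 2)) * (-(1 / 2)))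
        - M * 1) t :=
      (((h1.const_mul 2).sub (h2.const_mul 2)).add_const α).sub h3
    refine h.congr_deriv ?_
    simp only [hf'']
    ring
  refine concaveOn_of_hasDerivWithinAt2_nonpos (convex_Icc a b) (f' := f') (f'' := f'')
    (fun t _ => (hd1 t).continuousAt.continuousWithinAt)
    (fun t _ => (hd1 t).hasDerivWithinAt) (fun t _ => (hd2 t).hasDerivWithinAt) ?_
  intro t ht
  rw [interior_Icc] at ht
  have h1 : Real.exp (t / 2) ≤ Real.exp (b / 2) := Real.exp_le_exp.2 (by linarith [ht.2])
  have h2 : Real.exp (-(t / 2)) ≤ 1 := by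
    rw [Real.exp_le_one_iff]
    linarith [ht.1]
  simp only [hf'']
  linarith

/-- Hinge inequality: for `a, b ≥ 0`, `a + b = 1`,
`max (a x + b y - L) 0 ≤ a · max (x - L) 0 + b · max (y - L) 0`. -/
theorem max_sub_zero_convex_ineq (x y L a b : ℝ) (ha : 0 ≤ a) (hb : 0 ≤ b) (hab : a + b = 1) :
    max (a * x + b * y - L) 0 ≤ a * max (x - L) 0 + b * max (y - L) 0 := by
  refine max_le ?_ ?_
  · have h1 := mul_le_mul_of_nonneg_left (le_max_left (x - L) 0) ha
    have h2 := mul_le_mul_of_nonneg_left (le_max_left (y - L) 0) hb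
    have h5 : a * x + b * y - L = a * (x - L) + b * (y - L) := by linear_combination L * hab
    rw [h5]
    exact add_le_add h1 h2
  · have h1 : 0 ≤ max (x - L) 0 := le_max_right _ _
    have h2 : 0 ≤ max (y - L) 0 := le_max_right _ _
    positivity

/-- The prime hinge sum `φ(t) = ∑_{n ≤ e^{t}} Λ(n) n^{-1/2} (t - log n)` is convex on every `[0, b]`
(there it is the finite sum `∑_{n ≤ ⌈e^b⌉} Λ(n) n^{-1/2} max(t - log n, 0)` of convex hinges). -/
theorem convexOn_zetaScrewPrimeSum (b : ℝ) : ConvexOn ℝ (Icc 0 b) zetaScrewPrimeSum := by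
  set M : ℕ := ⌈Real.exp b⌉₊ with hM
  have heq : EqOn (fun t : ℝ => ∑ n ∈ Finset.Icc 1 M,
      ArithmeticFunction.vonMangoldt n / Real.sqrt n * max (t - Real.log n) 0)
      zetaScrewPrimeSum (Icc 0 b) := by
    intro t ht
    have habs : |t| = t := abs_of_nonneg ht.1
    have hle : Real.exp |t| ≤ M := by
      rw [habs]
      exact (Real.exp_le_exp.2 ht.2).trans (Nat.le_ceil _)
    rw [zetaScrewPrimeSum_eq_sum_max hle, habs]
  refine ConvexOn.congr ?_ heq
  refine ⟨convex_Icc 0 b, fun x _ y _ a c ha hc hac => ?_⟩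
  simp only [smul_eq_mul]
  rw [Finset.mul_sum, Finset.mul_sum, ← Finset.sum_add_distrib]
  refine Finset.sum_le_sum fun n _ => ?_
  have hc0 : 0 ≤ (ArithmeticFunction.vonMangoldt n : ℝ) / Real.sqrt n :=
    div_nonneg ArithmeticFunction.vonMangoldt_nonneg (Real.sqrt_nonneg _)
  have h := max_sub_zero_convex_ineq x y (Real.log n) a c ha hc hac
  calc (ArithmeticFunction.vonMangoldt n : ℝ) / Real.sqrt n * max (a * x + c * y - Real.log n) 0
      ≤ ArithmeticFunction.vonMangoldt n / Real.sqrt n *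
          (a * max (x - Real.log n) 0 + c * max (y - Real.log n) 0) :=
        mul_le_mul_of_nonneg_left h hc0
    _ = a * (ArithmeticFunction.vonMangoldt n / Real.sqrt n * max (x - Real.log n) 0)
          + c * (ArithmeticFunction.vonMangoldt n / Real.sqrt n * max (y - Real.log n) 0) := by
        ring

/-- `t ↦ e^{l t}` is convex on `ℝ` for every real `l`. -/
theorem convexOn_exp_mul (l : ℝ) : ConvexOn ℝ univ (fun t : ℝ => Real.exp (l * t)) := by
  refine ⟨convex_univ, fun x _ y _ a b ha hb hab => ?_⟩
  have h := convexOn_exp.2 (mem_univ (l * x)) (mem_univ (l * y)) ha hb hab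
  simp only [smul_eq_mul] at h ⊢
  convert h using 2
  ring

/-- The Hurwitz–Lerch term `t ↦ e^{-t/2} Φ(e^{-2t}, 2, 1/4) = ∑_k e^{-(2k+1/2)t} (k+1/4)^{-2}` is
convex on `[0, ∞)` (a convergent sum of convex exponentials). -/
theorem convexOn_exp_mul_hurwitzLerchQuarter :
    ConvexOn ℝ (Ici 0) (fun t : ℝ => Real.exp (-(t / 2)) * hurwitzLerchQuarter t) := by
  refine ⟨convex_Ici 0, fun x hx y hy a b ha hb hab => ?_⟩
  have hz : 0 ≤ a * x + b * y := by
    have hx' : (0 : ℝ) ≤ x := hx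
    have hy' : (0 : ℝ) ≤ y := hy
    positivity
  simp only [smul_eq_mul]
  unfold hurwitzLerchQuarter
  rw [abs_of_nonneg hz, abs_of_nonneg (show (0:ℝ) ≤ x from hx),
    abs_of_nonneg (show (0:ℝ) ≤ y from hy)]
  have hsx := summable_hurwitzLerchQuarter x
  have hsy := summable_hurwitzLerchQuarter y
  have hsz := summable_hurwitzLerchQuarter (a * x + b * y)
  rw [abs_of_nonneg hz] at hsz
  rw [abs_of_nonneg (show (0:ℝ) ≤ x from hx)] at hsx
  rw [abs_of_nonneg (show (0:ℝ) ≤ y from hy)] at hsy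
  rw [← tsum_mul_left, ← tsum_mul_left, ← tsum_mul_left, ← tsum_mul_left, ← tsum_mul_left,
    ← (hsx.mul_left _ |>.mul_left _).tsum_add (hsy.mul_left _ |>.mul_left _)]
  refine (hsz.mul_left _).tsum_le_tsum (fun k => ?_)
    ((hsx.mul_left _ |>.mul_left _).add (hsy.mul_left _ |>.mul_left _))
  -- termwise: convexity of `t ↦ exp (-(1/2 + 2k) t)`
  have hk : (0 : ℝ) < ((k : ℝ) + 1 / 4) ^ 2 := by positivity
  have hconv := (convexOn_exp_mul (-(1 / 2 + 2 * (k : ℝ)))).2 (mem_univ x) (mem_univ y) ha hb hab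
  simp only [smul_eq_mul] at hconv
  have e1 : ∀ s : ℝ, Real.exp (-(s / 2)) * (Real.exp (-(2 * s * k)) / ((k : ℝ) + 1 / 4) ^ 2)
      = Real.exp (-(1 / 2 + 2 * (k : ℝ)) * s) / ((k : ℝ) + 1 / 4) ^ 2 := by
    intro s
    rw [mul_div_assoc', ← Real.exp_add]
    congr 2
    ring
  rw [e1, e1, e1, div_le_iff₀ hk]
  calc Real.exp (-(1 / 2 + 2 * (k : ℝ)) * (a * x + b * y))
      ≤ a * Real.exp (-(1 / 2 + 2 * (k : ℝ)) * x) + b * Real.exp (-(1 / 2 + 2 * (k : ℝ)) * y) :=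
        hconv
    _ = (a * (Real.exp (-(1 / 2 + 2 * (k : ℝ)) * x) / ((k : ℝ) + 1 / 4) ^ 2)
          + b * (Real.exp (-(1 / 2 + 2 * (k : ℝ)) * y) / ((k : ℝ) + 1 / 4) ^ 2))
          * ((k : ℝ) + 1 / 4) ^ 2 := by
        field_simp


/-! ## Semiconcavity of `Ψ` -/

/-- **Prime-side semiconcavity of `Ψ`.** For `t₀ ≥ 1` and `M = e^{(t₀+1)/2} + 1`, the function
`t ↦ Ψ(t) - M t²/2` is concave on the window `[t₀ - 1, t₀ + 1]`: by Suzuki2023 (1.1),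
`Ψ = (4(e^{t/2}+e^{-t/2}-2) - c₀ t/2 + C/4) - φ(t) - ¼ e^{-t/2} Φ(e^{-2t},2,¼)` with the bracket
smooth of second derivative `e^{t/2} + e^{-t/2} ≤ M` on the window, the prime hinge sum `φ` convex
and the Hurwitz–Lerch term convex. -/
theorem concaveOn_zetaScrew_sub_quad {t₀ : ℝ} (ht₀ : 1 ≤ t₀) :
    ConcaveOn ℝ (Icc (t₀ - 1) (t₀ + 1))
      (fun t : ℝ => zetaScrew t - (Real.exp ((t₀ + 1) / 2) + 1) / 2 * t ^ 2) := by
  set M : ℝ := Real.exp ((t₀ + 1) / 2) + 1 with hM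
  set c₀ : ℝ := Real.eulerMascheroniConstant + Real.pi / 2 + 3 * Real.log 2 + Real.log Real.pi
    with hc₀
  set C : ℝ := ∑' k : ℕ, 1 / ((k : ℝ) + 1 / 4) ^ 2 with hC
  have hsub0 : Icc (t₀ - 1) (t₀ + 1) ⊆ Ici 0 := fun t ht => by
    simp only [mem_Ici]; linarith [ht.1]
  have hsub1 : Icc (t₀ - 1) (t₀ + 1) ⊆ Icc 0 (t₀ + 1) := fun t ht =>
    ⟨by linarith [ht.1], ht.2⟩
  -- the smooth part minus the quadratic is concave
  have h1 : ConcaveOn ℝ (Icc (t₀ - 1) (t₀ + 1)) (fun t : ℝ =>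
      4 * (Real.exp (t / 2) + Real.exp (-(t / 2)) - 2) + (-(c₀ / 2)) * t + C / 4 - M / 2 * t ^ 2) :=
    concaveOn_arch_sub_quad (-(c₀ / 2)) (C / 4) (by linarith) le_rfl
  -- the prime sum plus the Hurwitz–Lerch term is convex
  have h2 : ConvexOn ℝ (Icc (t₀ - 1) (t₀ + 1)) (fun t : ℝ =>
      zetaScrewPrimeSum t + (1 / 4) * (Real.exp (-(t / 2)) * hurwitzLerchQuarter t)) :=
    ((convexOn_zetaScrewPrimeSum (t₀ + 1)).subset hsub1 (convex_Icc _ _)).add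
      ((convexOn_exp_mul_hurwitzLerchQuarter.subset hsub0 (convex_Icc _ _)).smul
        (by norm_num : (0 : ℝ) ≤ 1 / 4))
  refine (h1.sub h2).congr fun t ht => ?_
  have ht0 : 0 ≤ t := hsub0 ht
  simp only [Pi.sub_apply]
  rw [zetaScrew_eq t, abs_of_nonneg ht0]
  ring

/-- A concave function on a real set admits a supergradient at every interior point:
`Q(t) ≤ Q(t₀) + q (t - t₀)` on the set (take `-q` = the right derivative of the convex `-Q`). -/
theorem exists_supergradient_of_concaveOn {D : Set ℝ} {Q : ℝ → ℝ} {t₀ : ℝ}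
    (hQ : ConcaveOn ℝ D Q) (ht₀ : t₀ ∈ interior D) :
    ∃ q : ℝ, ∀ t ∈ D, Q t ≤ Q t₀ + q * (t - t₀) := by
  have hF : ConvexOn ℝ D (-Q) := hQ.neg
  set p : ℝ := derivWithin (-Q) (Ioi t₀) t₀ with hp
  refine ⟨-p, fun t ht => ?_⟩
  rcases lt_trichotomy t₀ t with hlt | heq | hgt
  · have h := hF.rightDeriv_le_slope_of_mem_interior ht₀ ht hlt
    rw [← hp, slope_def_field] at h
    simp only [Pi.neg_apply] at h
    rw [le_div_iff₀ (sub_pos.2 hlt)] at h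
    linarith
  · subst heq; simp
  · have h := hF.slope_le_leftDeriv_of_mem_interior ht ht₀ hgt
    have h' := hF.leftDeriv_le_rightDeriv_of_mem_interior ht₀
    rw [← hp] at h'
    rw [slope_def_field] at h
    simp only [Pi.neg_apply] at h
    rw [div_le_iff₀ (sub_pos.2 hgt)] at h
    nlinarith

/-- **One-sided Taylor bound for `Ψ`** (semiconcavity in usable form). For `t₀ ≥ 1` there is a
slope `p` with `Ψ(t) ≤ Ψ(t₀) + p (t - t₀) + ½ (e^{(t₀+1)/2} + 1) (t - t₀)²` for all
`t ∈ [t₀ - 1, t₀ + 1]`. -/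
theorem zetaScrew_le_taylor {t₀ : ℝ} (ht₀ : 1 ≤ t₀) :
    ∃ p : ℝ, ∀ t ∈ Icc (t₀ - 1) (t₀ + 1),
      zetaScrew t ≤ zetaScrew t₀ + p * (t - t₀)
        + (Real.exp ((t₀ + 1) / 2) + 1) / 2 * (t - t₀) ^ 2 := by
  set M : ℝ := Real.exp ((t₀ + 1) / 2) + 1 with hM
  have hint : t₀ ∈ interior (Icc (t₀ - 1) (t₀ + 1)) := by
    rw [interior_Icc]; exact ⟨by linarith, by linarith⟩
  obtain ⟨q, hq⟩ := exists_supergradient_of_concaveOn (concaveOn_zetaScrew_sub_quad ht₀) hint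
  refine ⟨q + M * t₀, fun t ht => ?_⟩
  have h := hq t ht
  have e : M / 2 * t ^ 2 - M / 2 * t₀ ^ 2 = M * t₀ * (t - t₀) + M / 2 * (t - t₀) ^ 2 := by ring
  linarith


/-! ## The Nyquist step: sparse one-sided node bounds give an eventual floor -/

/-- **Nyquist step (tail floor).** If the node set `N` meets every interval
`[a, a + √(K/(e^{(a+2)/2}+1))]` for `a ≥ T₀` and `Ψ ≥ -K` on `N`, then `Ψ ≥ -2K` eventually.
Indeed, if `Ψ(t₀) < -2K` for a large `t₀`, the one-sided Taylor bound `zetaScrew_le_taylor` keeps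
`Ψ < -K` on a one-sided window of length `√(K/(e^{(t₀+1)/2}+1))` next to `t₀` (to the right if the
slope `p ≤ 0`, to the left if `p > 0`), and that window contains a node. -/
theorem tailFloor {K : ℝ} {N : Set ℝ} (hK : 0 < K)
    (hN : ∃ T₀ : ℝ, ∀ a : ℝ, T₀ ≤ a →
      ∃ x ∈ N, a ≤ x ∧ x ≤ a + Real.sqrt (K / (Real.exp ((a + 2) / 2) + 1)))
    (hΨN : ∀ x ∈ N, -K ≤ zetaScrew x) :
    ∃ T₁ : ℝ, ∀ t : ℝ, T₁ ≤ t → -(2 * K) ≤ zetaScrew t := by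
  obtain ⟨T₀, hT₀⟩ := hN
  refine ⟨max (T₀ + 1) (max 1 (2 * K)), fun t₀ ht₀ => ?_⟩
  obtain ⟨h1, h2, h3⟩ : T₀ + 1 ≤ t₀ ∧ 1 ≤ t₀ ∧ 2 * K ≤ t₀ := by simpa [max_le_iff] using ht₀
  by_contra hlt
  rw [not_le] at hlt
  set M : ℝ := Real.exp ((t₀ + 1) / 2) + 1 with hM
  have hMpos : 0 < M := by positivity
  -- `K ≤ M`, so the window length `δ = √(K/M)` is at most `1`
  have hKM : K ≤ M := by
    have := Real.add_one_le_exp ((t₀ + 1) / 2)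
    linarith
  have hKM' : K / M ≤ 1 := by rwa [div_le_one hMpos]
  set δ : ℝ := Real.sqrt (K / M) with hδ
  have hδpos : 0 < δ := Real.sqrt_pos.2 (div_pos hK hMpos)
  have hδ1 : δ ≤ 1 := by
    rw [hδ, ← Real.sqrt_one]
    exact Real.sqrt_le_sqrt hKM'
  have hδsq : δ ^ 2 = K / M := Real.sq_sqrt (div_pos hK hMpos).le
  -- the gap at any `a` with `a + 2 ≥ t₀ + 1` is at most `δ`
  have hgap : ∀ a : ℝ, t₀ + 1 ≤ a + 2 →
      Real.sqrt (K / (Real.exp ((a + 2) / 2) + 1)) ≤ δ := by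
    intro a ha
    rw [hδ]
    apply Real.sqrt_le_sqrt
    apply div_le_div_of_nonneg_left hK.le hMpos
    have := Real.exp_le_exp.2 (show (t₀ + 1) / 2 ≤ (a + 2) / 2 by linarith)
    linarith
  obtain ⟨p, hp⟩ := zetaScrew_le_taylor h2
  rcases le_or_gt p 0 with hp0 | hp0
  · -- go right: a node in `[t₀, t₀ + g(t₀)]`
    obtain ⟨x, hxN, hx1, hx2⟩ := hT₀ t₀ (by linarith)
    have hg := hgap t₀ (by linarith)
    have hxδ : x - t₀ ≤ δ := by linarith
    have hxw : x ∈ Icc (t₀ - 1) (t₀ + 1) := ⟨by linarith, by linarith⟩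
    have hT := hp x hxw
    have hsq : (x - t₀) ^ 2 ≤ δ ^ 2 := by
      apply pow_le_pow_left₀ (by linarith) hxδ
    have hquad : M / 2 * (x - t₀) ^ 2 ≤ K / 2 := by
      calc M / 2 * (x - t₀) ^ 2 ≤ M / 2 * δ ^ 2 := by gcongr
        _ = K / 2 := by rw [hδsq]; field_simp
    have hlin : p * (x - t₀) ≤ 0 := mul_nonpos_of_nonpos_of_nonneg hp0 (by linarith)
    have := hΨN x hxN
    linarith
  · -- go left: a node in `[t₀ - δ, t₀]`
    obtain ⟨x, hxN, hx1, hx2⟩ := hT₀ (t₀ - δ) (by linarith)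
    have hg := hgap (t₀ - δ) (by linarith)
    have hxle : x ≤ t₀ := by linarith
    have hxw : x ∈ Icc (t₀ - 1) (t₀ + 1) := ⟨by linarith, by linarith⟩
    have hT := hp x hxw
    have hsq : (x - t₀) ^ 2 ≤ δ ^ 2 := by
      rw [← neg_sq, neg_sub]
      apply pow_le_pow_left₀ (by linarith) (by linarith)
    have hquad : M / 2 * (x - t₀) ^ 2 ≤ K / 2 := by
      calc M / 2 * (x - t₀) ^ 2 ≤ M / 2 * δ ^ 2 := by gcongr
        _ = K / 2 := by rw [hδsq]; field_simp
    have hlin : p * (x - t₀) ≤ 0 := mul_nonpos_of_nonneg_of_nonpos hp0.le (by linarith)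
    have := hΨN x hxN
    linarith

/-- **Global floor.** Under the hypotheses of the door, `Ψ ≥ -K'` on `[0, ∞)` for some `K'`:
the tail floor `tailFloor` beyond `T₁` and continuity of `Ψ` on the compact `[0, T₁]`. -/
theorem globalFloor {K : ℝ} {N : Set ℝ} (hK : 0 < K)
    (hN : ∃ T₀ : ℝ, ∀ a : ℝ, T₀ ≤ a →
      ∃ x ∈ N, a ≤ x ∧ x ≤ a + Real.sqrt (K / (Real.exp ((a + 2) / 2) + 1)))
    (hΨN : ∀ x ∈ N, -K ≤ zetaScrew x) :
    ∃ K' : ℝ, ∀ t : ℝ, 0 ≤ t → -K' ≤ zetaScrew t := by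
  obtain ⟨T₁, hT₁⟩ := tailFloor hK hN hΨN
  obtain ⟨m, hm⟩ := (isCompact_Icc (a := (0 : ℝ)) (b := T₁)).bddBelow_image
    continuous_zetaScrew.continuousOn
  refine ⟨max (2 * K) (-m), fun t ht => ?_⟩
  rcases le_or_gt t T₁ with h | h
  · have : m ≤ zetaScrew t := hm ⟨t, ⟨ht, h⟩, rfl⟩
    have := le_max_right (2 * K) (-m)
    linarith
  · have := hT₁ t h.le
    have := le_max_left (2 * K) (-m)
    linarith

/-! ## The door -/

/-- **RH-free Nyquist door** (`ScrewQuarticNodes.SparseNodeDoor`, stmt-RiemannHypothesis-22169, in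
unfolded form): for every `K > 0` and node set `N ⊆ ℝ` meeting every `[a, a + √(K/(e^{(a+2)/2}+1))]`
for large `a`, if `Ψ ≥ -K` on `N` then the Riemann hypothesis holds. Proof: `globalFloor` gives
`Ψ ≥ -K'` on `[0, ∞)`; the tree's robust Landau detection
`IntegerScrewDiscreteLandau.robustLandau` then excludes zeros of `ξ(1/2 + ·)` in `Re > 0`, i.e.
zeros of `ζ` with `1/2 < Re s < 1`, which is RH (`quasiRiemannHypothesis_one_half_iff_holds`).
This is a DETECTION theorem; nothing here bears on the truth of RH. -/
theorem sparseNodeDoor (K : ℝ) (N : Set ℝ) (hK : 0 < K)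
    (hN : ∃ T₀ : ℝ, ∀ a : ℝ, T₀ ≤ a →
      ∃ x ∈ N, a ≤ x ∧ x ≤ a + Real.sqrt (K / (Real.exp ((a + 2) / 2) + 1)))
    (hΨN : ∀ x ∈ N, -K ≤ Literature.NumberTheory.LFunctions.zetaScrew x) :
    _root_.RiemannHypothesis := by
  obtain ⟨K', hK'⟩ := globalFloor hK hN hΨN
  refine quasiRiemannHypothesis_one_half_iff_holds.1 fun s hs h1' h2' ↦ ?_
  have hξ : riemannXi s = 0 := (riemannXi_eq_zero_iff_holds s).2 ⟨hs, by linarith, h2'⟩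
  have hw : 0 < (s - 1 / 2).re := by simp; linarith
  refine IntegerScrewDiscreteLandau.robustLandau K' hK' (s - 1 / 2) hw ?_
  rw [show (1 / 2 : ℂ) + (s - 1 / 2) = s by ring]
  exact hξ


/-- **Crux `ScrewQuarticNodes.SparseNodeDoor` (stmt-RiemannHypothesis-22169) closed BY NAME**: the
route decl, unfolded, is `sparseNodeDoor` token for token.  A detection theorem; nothing here bears
on the truth of RH. -/
theorem sparseNodeDoor_proof :
    Summit.RiemannHypothesis.RiemannHypothesis.Theses.ScrewQuarticNodes.SparseNodeDoor := by
  unfold Summit.RiemannHypothesis.RiemannHypothesis.Theses.ScrewQuarticNodes.SparseNodeDoor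
  intro K N hK hN hΨN
  exact sparseNodeDoor K N hK hN hΨN

end Summit.RiemannHypothesis.RiemannHypothesis.Theorems.ScrewQuarticNodesSparseNodeDoor

end
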